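import Summits.HodgeConjecture.CorCM.Census.IcosicDicyclicMinimality

/-!
# Icosic atlas, type `Dic₅` (second sequel): growth from the exceptional set — every coordinate vector lies in `X_L ⊔ P ⊔ A` (first half of the kernel
# certificate `μ(Dic₅) ≤ 51`; the lattice theorem is completed in `Census/IcosicDicyclicLattice.lean`)

COR-CM (cell `pub-hodgecm2`), count-neutral kernel census by the literature seat lit-andre-3 (gen 15; claim ICOSIC-ATLAS; cell memo
`HOME/pub-hodgecm2-lit-andre-3/PORTFOLIO-lit-andre-3-g15.md`), second sequel of `Census/IcosicDicyclicSpecies.lean` (imports `Census/IcosicDicyclicMinimality.lean`; same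
conventions, dictionary, citations); method VERBATIM `Census/IcosicSplitGrowth.lean` (the dicyclic type has no spanning block either): growth from the EXCEPTIONAL SET
`X = {S, B₄₃, B₄₇, B₄₈, B₅₀}` (`84` labels, `42` conjugate pairs) carrying the internal faces `0–3` (all tables produced and verified by `scratch/latticedata_dic5.py`):
translations act linearly, `P` and `A` are translation stable; `W := X_L ⊔ (P ⊔ A)` is translation stable and contains every coordinate vector (`reach_spec`,
`single_mem_W`, `mem_W`); `X_L ≤ X_R ⊔ P` (`XL_le`) with `X_R` = the `42` coordinate vectors `e_{rep r}`, one per conjugate pair.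
No named fact, no `sorry`.  HC_CM is not proved anywhere in this cell; nothing here is a headline.

## References
* [Pohlmann1968] H. Pohlmann, Algebraic cycles on abelian varieties of complex multiplication type, Ann. of Math. 88 (1968), Thm 1.
* [Milne1999] J. S. Milne, Lefschetz motives and the Tate conjecture, Compositio Math. 117 (1999), Prop. 2.1, p. 54.
-/

namespace Summit.HodgeConjecture.CorCM.Census.IcosicDicyclicSpecies

open Finset QuaternionGroup

/-! ## Translations as linear maps; stability of `P` and `A` -/

/-- Translation by `g ∈ Dic₅` as a `ℤ`-linear map. [folklore] -/
def translL (g : G) : (Pt → ℤ) →ₗ[ℤ] (Pt → ℤ) where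
  toFun := transl g
  map_add' v w := by funext y; rfl
  map_smul' c v := by funext y; rfl

/-- Translates compose. [folklore] -/
theorem transl_transl (g h : G) (v : Pt → ℤ) : transl g (transl h v) = transl (g * h) v := by
  funext y
  show v (act h⁻¹ (act g⁻¹ y)) = v (act (g * h)⁻¹ y)
  rw [← act_mul, mul_inv_rev]

/-- The translate of an indicator is the indicator of the translated set. [folklore] -/
theorem transl_ind (g : G) (S : Finset Pt) : transl g (ind S) = ind (S.image (act g)) := by
  funext y
  show (if act g⁻¹ y ∈ S then (1 : ℤ) else 0) = if y ∈ S.image (act g) then 1 else 0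
  have key : act g⁻¹ y ∈ S ↔ y ∈ S.image (act g) := by
    rw [Finset.mem_image]
    constructor
    · intro h
      exact ⟨act g⁻¹ y, h, (actEquiv g).right_inv y⟩
    · rintro ⟨x, hx, rfl⟩
      rw [show act g⁻¹ (act g x) = x from (actEquiv g).left_inv x]
      exact hx
  by_cases h : act g⁻¹ y ∈ S
  · rw [if_pos h, if_pos (key.mp h)]
  · rw [if_neg h, if_neg (fun h' => h (key.mpr h'))]

/-- The translate of a coordinate vector. [folklore] -/
theorem transl_ind_singleton (g : G) (x : Pt) : transl g (ind {x}) = ind {act g x} := by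
  rw [transl_ind, Finset.image_singleton]

/-- `c = a 5` is central. [folklore] -/
theorem a5_comm : ∀ g : G, g * a 5 = a 5 * g := by decide

/-- The translate of a conjugate pair is a conjugate pair. [folklore] -/
theorem transl_pairVec (g : G) (x : Pt) : transl g (pairVec x) = pairVec (act g x) := by
  rw [pairVec, transl_ind, Finset.image_insert, Finset.image_singleton, ← act_mul, a5_comm g, act_mul]
  rfl

/-- A span of a translation-stable family of generators is translation stable. [folklore] -/
theorem span_transl {ι : Type*} (f : ι → Pt → ℤ) (g : G)
    (h : ∀ i, transl g (f i) ∈ Submodule.span ℤ (Set.range f)) {v : Pt → ℤ} (hv : v ∈ Submodule.span ℤ (Set.range f)) :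
    transl g v ∈ Submodule.span ℤ (Set.range f) := by
  have h1 : Submodule.map (translL g) (Submodule.span ℤ (Set.range f)) ≤ Submodule.span ℤ (Set.range f) := by
    rw [Submodule.map_span]
    refine Submodule.span_le.mpr ?_
    rintro _ ⟨_, ⟨i, rfl⟩, rfl⟩
    exact h i
  exact h1 (Submodule.mem_map_of_mem hv)

/-- `P` is translation stable. [folklore] -/
theorem pairs_transl (g : G) {v : Pt → ℤ} (hv : v ∈ pairs) : transl g v ∈ pairs :=
  span_transl pairVec g (fun x => by rw [transl_pairVec]; exact Submodule.subset_span ⟨act g x, rfl⟩) hv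

/-- `A` is translation stable. [folklore] -/
theorem atoms_transl (g : G) {v : Pt → ℤ} (hv : v ∈ atoms) : transl g v ∈ atoms :=
  span_transl (fun p : G × Fin 51 => transl p.1 (atomVec p.2)) g
    (fun p => by rw [transl_transl]; exact Submodule.subset_span ⟨(g * p.1, p.2), rfl⟩) hv

/-! ## The exceptional set `X = {S, B₄₃, B₄₇, B₄₈, B₅₀}` and `W` -/

/-- Index set of the `84` labels of `X`: the four surface labels and the labels of the four tenfolds of `X`. [folklore] -/
abbrev XIdx := ZMod 4 ⊕ (Fin 4 × G)

/-- The tenfolds of `X` as `q`-indices (blocks `43, 47, 48, 50`). [folklore] -/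
def xT : Fin 4 → Fin 51 := ![42, 46, 47, 49]

/-- The labels of `X`. [folklore] -/
def xlab : XIdx → Pt
  | Sum.inl u => s u
  | Sum.inr (j, g) => q (xT j) g

/-- `X_L`: the coordinate vectors of the labels of `X`. [folklore] -/
def XL : Submodule ℤ (Pt → ℤ) := Submodule.span ℤ (Set.range fun p : XIdx => ind {xlab p})

set_option maxRecDepth 100000 in
/-- One representative per conjugate pair of `X` (`42` pairs): `s 0`, `s 1` and the lower members `q b (a i)`, `q b (xa i)`, `i < 5`. [folklore] -/
def rep : Fin 42 → Pt :=
  ![s 0, s 1, q 42 (a 0), q 42 (a 1), q 42 (a 2), q 42 (a 3), q 42 (a 4), q 42 (xa 0), q 42 (xa 1), q 42 (xa 2), q 42 (xa 3), q 42 (xa 4), q 46 (a 0), q 46 (a 1),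
    q 46 (a 2), q 46 (a 3), q 46 (a 4), q 46 (xa 0), q 46 (xa 1), q 46 (xa 2), q 46 (xa 3), q 46 (xa 4), q 47 (a 0), q 47 (a 1), q 47 (a 2), q 47 (a 3), q 47 (a 4), q 47 (xa 0),
    q 47 (xa 1), q 47 (xa 2), q 47 (xa 3), q 47 (xa 4), q 49 (a 0), q 49 (a 1), q 49 (a 2), q 49 (a 3), q 49 (a 4), q 49 (xa 0), q 49 (xa 1), q 49 (xa 2), q 49 (xa 3), q 49 (xa 4)]

/-- `X_R`: one coordinate vector per conjugate pair of `X`. [folklore] -/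
def XR : Submodule ℤ (Pt → ℤ) := Submodule.span ℤ (Set.range fun r : Fin 42 => ind {rep r})

/-- `W = X_L + P + A`. [folklore] -/
def W : Submodule ℤ (Pt → ℤ) := XL ⊔ (pairs ⊔ atoms)

/-- `X` is a union of blocks: translates of labels of `X` are labels of `X`. [folklore] -/
theorem act_xlab (g : G) (p : XIdx) : ∃ p' : XIdx, act g (xlab p) = xlab p' := by
  rcases p with u | ⟨j, h⟩
  · exact ⟨Sum.inl (eps g + u), rfl⟩
  · exact ⟨Sum.inr (j, g * h), rfl⟩

/-- `X_L` is translation stable. [folklore] -/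
theorem XL_transl (g : G) {v : Pt → ℤ} (hv : v ∈ XL) : transl g v ∈ XL :=
  span_transl (fun p : XIdx => ind {xlab p}) g (fun p => by
    obtain ⟨p', hp'⟩ := act_xlab g p
    rw [transl_ind_singleton, hp']
    exact Submodule.subset_span ⟨p', rfl⟩) hv

/-- `W` is translation stable. [folklore] -/
theorem W_transl (g : G) {v : Pt → ℤ} (hv : v ∈ W) : transl g v ∈ W := by
  rw [W, Submodule.mem_sup] at hv
  obtain ⟨b, hb, w, hw, rfl⟩ := hv
  rw [Submodule.mem_sup] at hw
  obtain ⟨p, hp, a, ha, rfl⟩ := hw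
  have e : transl g (b + (p + a)) = transl g b + (transl g p + transl g a) := by funext y; rfl
  rw [e]
  exact Submodule.add_mem _ (Submodule.mem_sup_left (XL_transl g hb))
    (Submodule.mem_sup_right (Submodule.add_mem _ (Submodule.mem_sup_left (pairs_transl g hp)) (Submodule.mem_sup_right (atoms_transl g ha))))

/-- A conjugate pair is the sum of its two coordinate vectors. [folklore] -/
theorem pairVec_eq (x : Pt) : pairVec x = ind {x} + ind {act (a 5) x} := by
  funext y
  show (if y ∈ ({x, act (a 5) x} : Finset Pt) then (1 : ℤ) else 0) =
    (if y ∈ ({x} : Finset Pt) then 1 else 0) + (if y ∈ ({act (a 5) x} : Finset Pt) then 1 else 0)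
  simp only [Finset.mem_insert, Finset.mem_singleton]
  have hne : act (a 5) x ≠ x := hodgeVec_conj.2 x
  have hne' : x ≠ act (a 5) x := fun e => hne e.symm
  by_cases h1 : y = x <;> by_cases h2 : y = act (a 5) x <;> simp [h1, h2, hne, hne']

set_option maxRecDepth 100000 in set_option maxHeartbeats 4000000 in set_option synthInstance.maxHeartbeats 400000 in
/-- Every label of `X` is a representative or the conjugate of one; labels of step `0` are labels of `X`. [folklore] -/
theorem xlab_spec : (∀ p : XIdx, ∃ r : Fin 42, xlab p = rep r ∨ xlab p = act (a 5) (rep r)) ∧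
    (∀ x : Pt, rank.getD (blockOf x) 0 = 0 → ∃ p : XIdx, xlab p = x) := by
  refine ⟨by decide +kernel, by decide +kernel⟩

/-- `X_L ≤ X_R ⊔ P`: the conjugate coordinate vectors are pair minus representative. [folklore] -/
theorem XL_le : (XL : Submodule ℤ (Pt → ℤ)) ≤ XR ⊔ pairs := by
  refine Submodule.span_le.mpr ?_
  rintro _ ⟨p, rfl⟩
  show ind {xlab p} ∈ XR ⊔ pairs
  obtain ⟨r, hr⟩ := xlab_spec.1 p
  rcases hr with h | h
  · rw [h]
    exact Submodule.mem_sup_left (Submodule.subset_span ⟨r, rfl⟩)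
  · have e : ind {act (a 5) (rep r)} = pairVec (rep r) - ind {rep r} := by
      rw [pairVec_eq]; exact (add_sub_cancel_left _ _).symm
    rw [h, e]
    exact Submodule.sub_mem _ (Submodule.mem_sup_right (Submodule.subset_span ⟨rep r, rfl⟩))
      (Submodule.mem_sup_left (Submodule.subset_span ⟨r, rfl⟩))

/-! ## Every coordinate vector lies in `W` (growth from `X`) -/

set_option maxRecDepth 100000 in
/-- The label of growth face `k ≥ 4` in the block it introduces (for the internal faces `0–3`: some label of the face, unused). [folklore] -/
def newLabel : Fin 51 → Pt :=
  ![q 42 (a 0), q 42 (a 0), q 46 (a 0), q 46 (a 0), q 17 (xa 0), q 34 (a 0), q 8 (xa 2), q 28 (a 0), q 44 (a 7), q 45 (xa 6), q 43 (xa 1), q 38 (a 2), q 20 (xa 9), q 39 (a 9),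
    q 3 (xa 3), q 40 (xa 9), q 24 (a 1), q 33 (a 9), q 26 (xa 7), q 35 (xa 5), q 18 (a 8), q 48 (xa 1), q 50 (xa 5), q 29 (xa 1), q 31 (a 7), q 13 (a 4), q 14 (a 4), q 36 (xa 6),
    q 30 (a 8), q 32 (xa 7), q 41 (a 1), q 22 (xa 3), q 23 (a 2), q 1 (xa 7), q 9 (a 9), q 27 (a 0), q 16 (xa 5), q 37 (xa 0), q 11 (xa 3), q 19 (a 0), q 15 (xa 0), q 4 (xa 1),
    q 6 (xa 0), q 10 (a 0), q 0 (xa 2), q 21 (xa 6), q 25 (xa 2), q 12 (xa 3), q 2 (a 2), q 7 (xa 9), q 5 (a 2)]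

/-- The growth face introducing a block (list indexed by block; `0` on the blocks of `X`). [folklore] -/
def kOfBlock : List ℕ :=
  [0, 44, 33, 48, 14, 41, 50, 42, 49, 6, 34, 43, 38, 47, 25, 26, 40, 36, 4, 20, 39, 12, 45, 31, 32, 16, 46, 18, 35, 7, 23, 28, 24, 29, 17, 5, 19, 27, 37, 11, 13, 15, 30, 0, 10, 8, 9, 0, 0, 21, 0, 22]

/-- The face introducing the block of a label. [folklore] -/
def kOf (x : Pt) : Fin 51 := ⟨min (kOfBlock.getD (blockOf x) 0) 50, by omega⟩

/-- The translation carrying `newLabel (kOf x)` to `x` (a section of the quotient map of the block of `x`). [folklore] -/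
def shOf (x : Pt) : G :=
  match x, newLabel (kOf x) with
  | Sum.inl u, Sum.inl u₀ => if u - u₀ = 0 then a 0 else if u - u₀ = 1 then xa 0 else if u - u₀ = 2 then a 1 else xa 1
  | Sum.inr (_, h), Sum.inr (_, h₀) => h * h₀⁻¹
  | _, _ => 1

set_option maxRecDepth 100000 in set_option maxHeartbeats 4000000 in set_option synthInstance.maxHeartbeats 400000 in
/-- The growth structure re-read label by label: for a growth face `k ≥ 4`, `newLabel k` is one of its labels and its three other labels lie in blocks
of step `< stage k`; every label is of step `0` or the translate by `shOf` of the new label of the growth face reaching its block, at that step; no step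
exceeds `47`. [folklore] -/
theorem reach_spec : (∀ k : Fin 51, 4 ≤ k.val → newLabel k ∈ orbitRep k) ∧
    (∀ k : Fin 51, 4 ≤ k.val → (((orbitRep k).erase (newLabel k)).filter fun y => ¬ rank.getD (blockOf y) 0 < stage k).card = 0) ∧
    (∀ x : Pt, rank.getD (blockOf x) 0 = 0 ∨
      (act (shOf x) (newLabel (kOf x)) = x ∧ rank.getD (blockOf x) 0 = stage (kOf x) ∧ 4 ≤ (kOf x).val)) ∧
    (∀ x : Pt, rank.getD (blockOf x) 0 ≤ 47) := by
  refine ⟨by decide +kernel, by decide +kernel, by decide +kernel, by decide +kernel⟩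

/-- A face monomial is its new label plus the coordinate vectors of its other labels. [folklore] -/
theorem atomVec_split (k : Fin 51) (h : newLabel k ∈ orbitRep k) :
    atomVec k = ind {newLabel k} + ∑ y ∈ (orbitRep k).erase (newLabel k), ind {y} := by
  have hsum : ∀ S : Finset Pt, ind S = ∑ y ∈ S, ind {y} := by
    intro S
    funext z
    rw [Finset.sum_apply]
    show (if z ∈ S then (1 : ℤ) else 0) = ∑ y ∈ S, (if z ∈ ({y} : Finset Pt) then (1 : ℤ) else 0)
    simp only [Finset.mem_singleton]
    rw [Finset.sum_ite_eq]
  rw [atomVec, hsum, ← Finset.add_sum_erase _ _ h]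

/-- **Every coordinate vector lies in `W`** (induction on the step at which the block of the label is reached from `X`). [folklore] -/
theorem single_mem_W (x : Pt) : ind ({x} : Finset Pt) ∈ W := by
  obtain ⟨hnew, hold, hreach, hbd⟩ := reach_spec
  suffices h : ∀ n : ℕ, ∀ x : Pt, rank.getD (blockOf x) 0 ≤ n → ind {x} ∈ W from h 47 x (hbd x)
  intro n
  induction n with
  | zero =>
    intro x hx
    obtain ⟨p, rfl⟩ := xlab_spec.2 x (Nat.le_zero.mp hx)
    exact Submodule.mem_sup_left (Submodule.subset_span ⟨p, rfl⟩)
  | succ n ih =>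
    intro x hx
    rcases Nat.lt_or_ge (rank.getD (blockOf x) 0) (n + 1) with hlt | hge
    · exact ih x (Nat.lt_succ_iff.mp hlt)
    · have heq : rank.getD (blockOf x) 0 = n + 1 := le_antisymm hx hge
      rcases hreach x with h0 | ⟨hact, hrk, h4⟩
      · omega
      · set k := kOf x with hk
        have hnewW : ind {newLabel k} ∈ W := by
          have hrest : (∑ y ∈ (orbitRep k).erase (newLabel k), ind {y}) ∈ W := by
            refine Submodule.sum_mem _ fun y hy => ih y ?_
            have hlt := not_not.mp (Finset.filter_eq_empty_iff.mp (Finset.card_eq_zero.mp (hold k h4)) hy)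
            omega
          have hA : atomVec k ∈ W := Submodule.mem_sup_right (Submodule.mem_sup_right (atomVec_mem k))
          have e : ind {newLabel k} = atomVec k - ∑ y ∈ (orbitRep k).erase (newLabel k), ind {y} := by
            rw [atomVec_split k (hnew k h4)]; abel
          rw [e]
          exact Submodule.sub_mem _ hA hrest
        rw [← hact, ← transl_ind_singleton]
        exact W_transl _ hnewW

/-- `W` is everything. [folklore] -/
theorem mem_W (v : Pt → ℤ) : v ∈ (W : Submodule ℤ (Pt → ℤ)) := by
  rw [pi_eq_sum_univ v]
  refine Submodule.sum_mem _ fun x _ => Submodule.smul_mem _ _ ?_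
  have e : (fun y : Pt => if x = y then (1 : ℤ) else 0) = ind {x} := by
    funext y; simp only [ind, Finset.mem_singleton, eq_comm]
  rw [e]
  exact single_mem_W x

end Summit.HodgeConjecture.CorCM.Census.IcosicDicyclicSpecies
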